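import Summits.QuantumFields.YangMills.Theorems.BalabanUVNodesN15KingModelGraphTreeDecayFieldPoints
import Summits.QuantumFields.YangMills.Theorems.BalabanUVNodesN15KingModelGraphTreeDecayProp36Kruskal

/-!
# BalabanUVNodes ∕ N15 — THE KING-MODEL RUNG (PART Α-i): THE STEP (3.57) ON KING's TORI — the field points are the UNIT BLOCKS of the rung's torus read at
# their base points, the one-point sum of part Α-h is the unit-lattice sum `Σ_{w ∈ T^{(k)}} e^{−c|w − u₀|} ≤ e^{c}·K_{d+1}(c)` (the tree's `tdistT_sumBound`),
# and part Α-h's theorem becomes: `r` field insertions with (3.45)-type majorants summed against a kernel with tree decay cost `(a(1 + 4r∕δ)e^{δ∕4r}K_{d+1}(δ∕4r))^r`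
# and half the rate — uniformly in the volume
# (Track A, DAG node N15 = NE2; FAN-OUT v1.1 §N15 s3 «KING-MODEL RUNG … NE2's analogue DECIDED in the model»)

HONEST FRAMING.  Count-neutral (cell `pub-ymgap`, seat `pub-ymgap-dag-n15-e` g29; `--supports stmt-QuantumFields-27366 --as helper` = K3⁸
`SpineGivenEndpointR13SepCoPHV`).  TEMPLATE LITERATURE: C. King, *The U(1) Higgs model. I. The continuum limit*, Commun. Math. Phys. **102** (1986) 649–677
[King1986], p. 662 ((3.55)–(3.57)): the field points `w_l ∈ T^{(k)}` of the insertions `A_k(w_l)` are UNIT-lattice points; on the rung's torus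
`Tor (fine (L^K) (kingVol L jv))` these are the blocks `b ∈ Tor (kingVol L jv)`, read at `basePt b`.  The kernel `E` and the insertions `A` stay hypotheses (the
kernels `KG_kρ^*(x, w)` of (3.44) tying a field point to the graph are not typed in the rung).  NOT Bałaban's `G(U)`; NOT a node discharge; nothing continuum ∕
ℝ⁴ ∕ OS ∕ mass-gap ∕ Clay.  0 `sorry`; standard axioms.  Text layer of p. 662 (`paper:king1986-cmp102-king-u1-higgs-i` p0014) re-read by this seat 2026-08-29.

THE PRINT.  p. 662 [PDF 14]: *«E^{(k)}(H, A^{(k)}; {y_i}, {z_q}) = Σ_{H̃} Σ_{w_1,…,w_r ∈ T^{(k)}} A_k(w_1)⋯A_k(w_r) E^{(k)}(H̃; {y_i}, {z_q}, {w_l}) (3.55) … we can use the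
exponential tree decay in (3.56) to sum over {w_l} and get (3.39)»*.

WHAT THIS FILE PROVES (namespace `Summit.QuantumFields.YangMills.BalabanUVNodes.N15KingModelRung.Curved`).
* §1 ★ `sum_exp_kingDist_basePt_le` — THE UNIT-LATTICE SUM in the unit-block distance of part Α-e: for `c > 0` and any fine point `u₀`,
  `Σ_{b ∈ Tor (kingVol)} exp[−c·|basePt b − u₀|] ≤ e^{c}·K_{d+1}(c)` (`K_{d+1}` = the tree's `latticeConst`; `|basePt b − u₀| ≥ |b − B(u₀)|_T − 1` by part Ψ
  `mul_tdistT_blockOf_le`, then `tdistT_sumBound`), independent of the volume and of `K`.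
* §2 ★★★ **`king_sum_fieldPoints_treeDecay`** — PART Α-h's (3.57) ON THE RUNG's TORUS: for a point set `U` of fine points with `u₀ ∈ U`, `r ≥ 1` field insertions
  at unit blocks with `|A(b)| ≤ a(1 + |basePt b − u₀|)`, and a kernel `|E(b_1, …, b_r)| ≤ B·exp[−δ·treeLength |·| (U ∪ {basePt b_l})]`:
  `|Σ_{b : Fin r → Tor (kingVol)} (Π_l A(b_l))·E(b)| ≤ B·exp[−(δ∕2)·treeLength |·| U]·(a·(1 + 4r∕δ)·(e^{δ∕(4r)}·K_{d+1}(δ∕(4r))))^r`.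

HONEST SCOPE.  (a) The summation step only; which kernels `E` arise ((3.43)–(3.55)) and Theorem 3.5 (3.39) are NOT typed.  (b) Constants per `(r, δ, d)`,
uniform in the volume `2L^{jv.m}` and in `K`.  Locators: [King1986] (3.45) p.661, (3.55)–(3.57) p.662, p.660.
-/

noncomputable section

namespace Summit.QuantumFields.YangMills.BalabanUVNodes.N15KingModelRung.Curved

open scoped BigOperators
open Finset
open Literature.MathematicalPhysics.QuantumFieldTheory.Balaban1983to89.B4Sect5Proof (latticeConst latticeConst_nonneg)
open Literature.MathematicalPhysics.QuantumFieldTheory.Balaban1983to89.B5Prop11Plancherel (Tor fine)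
open Literature.MathematicalPhysics.QuantumFieldTheory.King1986.Torus (tdistT tdistT_nonneg tdistT_symm tdistT_sumBound blockOf)
open Summit.QuantumFields.YangMills.BalabanUVNodes.N15KingModelRung (KingVolIndex kingVol kingVol_neZero basePt blockOf_basePt)
open Summit.QuantumFields.YangMills.BalabanUVNodes.N15KingModelRung.Graph

variable {d : ℕ} (L : ℕ) [NeZero L]

/-! ## §1 The unit-lattice exponential sum in the unit-block distance -/

section UnitSum

/-- ★ **THE UNIT-LATTICE SUM** `Σ_{b} e^{−c|basePt b − u₀|} ≤ e^{c}·K_{d+1}(c)` (`c > 0`): the base points of the unit blocks are at least `|b − B(u₀)|_T − 1` from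
`u₀` in the unit-block distance (part Ψ `mul_tdistT_blockOf_le`), and `Σ_b e^{−c|b − b₀|_T} ≤ K_{d+1}(c)` is the tree's `tdistT_sumBound` — the «sum over {w_l}»
letter of p. 662, uniformly in the volume. [cite: King1986, p.662 («sum over {w_l}»), (3.68) p.664] -/
theorem sum_exp_kingDist_basePt_le (jv : KingVolIndex d) {c : ℝ} (hc : 0 < c)
    (u₀ : haveI := kingVol_neZero L jv; Tor (fine (L ^ jv.K) (kingVol L jv))) :
    haveI := kingVol_neZero L jv
    ∑ b : Tor (kingVol L jv), Real.exp (-(c * kingDist L jv (basePt (L ^ jv.K) (kingVol L jv) b) u₀))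
      ≤ Real.exp c * latticeConst (d + 1) c := by
  haveI := kingVol_neZero L jv
  have hL0 : (0 : ℝ) < L := by exact_mod_cast Nat.pos_of_ne_zero (NeZero.ne L)
  have hN : (0 : ℝ) < (L : ℝ) ^ jv.K := pow_pos hL0 _
  set b₀ := blockOf (L ^ jv.K) (kingVol L jv) u₀ with hb₀
  -- each base point is at least `|b − b₀|_T − 1` away from `u₀`
  have hpt : ∀ b : Tor (kingVol L jv), Real.exp (-(c * kingDist L jv (basePt (L ^ jv.K) (kingVol L jv) b) u₀))
      ≤ Real.exp c * Real.exp (-(c * tdistT (kingVol L jv) b₀ b)) := fun b => by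
    have h := mul_tdistT_blockOf_le (L ^ jv.K) (kingVol L jv) (basePt (L ^ jv.K) (kingVol L jv) b) u₀
    rw [blockOf_basePt] at h
    push_cast at h
    have hdist : tdistT (kingVol L jv) b b₀ ≤ kingDist L jv (basePt (L ^ jv.K) (kingVol L jv) b) u₀ + 1 := by
      unfold kingDist
      rw [hb₀, ← sub_le_iff_le_add, le_div_iff₀ hN]
      nlinarith
    rw [← Real.exp_add, tdistT_symm _ b₀ b]
    exact Real.exp_le_exp.2 (by nlinarith [mul_le_mul_of_nonneg_left hdist hc.le])
  calc ∑ b : Tor (kingVol L jv), Real.exp (-(c * kingDist L jv (basePt (L ^ jv.K) (kingVol L jv) b) u₀))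
      ≤ ∑ b : Tor (kingVol L jv), Real.exp c * Real.exp (-(c * tdistT (kingVol L jv) b₀ b)) := sum_le_sum fun b _ => hpt b
    _ = Real.exp c * ∑ b : Tor (kingVol L jv), Real.exp (-(c * tdistT (kingVol L jv) b₀ b)) := by rw [mul_sum]
    _ ≤ Real.exp c * latticeConst (d + 1) c := mul_le_mul_of_nonneg_left (tdistT_sumBound (kingVol L jv) c hc b₀) (Real.exp_nonneg _)

end UnitSum

/-! ## §2 The step (3.57) on the rung's torus -/

section FieldPointsKing

/-- ★★★ **«SUM OVER {w_l}» ON KING's TORUS** — part Α-h `sum_fieldPoints_treeDecay` with the field points the UNIT BLOCKS read at their base points and the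
one-point sum discharged by §1: for fine points `U ∋ u₀`, `r ≥ 1` insertions at unit blocks with linearly growing majorants `|A(b)| ≤ a(1 + |basePt b − u₀|)`
((3.45)), and a kernel with tree decay in `U ∪ {basePt b_l}` at rate `δ > 0` of size `B`:
`|Σ_{b : Fin r → Tor (kingVol)} (Π_l A(b_l))·E(b)| ≤ B·exp[−(δ∕2)·treeLength |·| U]·(a·(1 + 4r∕δ)·(e^{δ∕(4r)}·K_{d+1}(δ∕(4r))))^r` — uniformly in the volume
and in `K`. [cite: King1986, (3.55)–(3.57) p.662 («we can use the exponential tree decay in (3.56) to sum over {w_l} and get (3.39)»), (3.45) p.661] -/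
theorem king_sum_fieldPoints_treeDecay (jv : KingVolIndex d)
    {U : Finset (haveI := kingVol_neZero L jv; Tor (fine (L ^ jv.K) (kingVol L jv)))}
    {u₀ : haveI := kingVol_neZero L jv; Tor (fine (L ^ jv.K) (kingVol L jv))} (hu₀ : u₀ ∈ U)
    {r : ℕ} (hr : 1 ≤ r) {δ a B : ℝ} (hδ : 0 < δ) (ha : 0 ≤ a) (hB : 0 ≤ B)
    (E : (Fin r → Tor (kingVol L jv)) → ℝ)
    (hE : haveI := kingVol_neZero L jv; ∀ b, |E b| ≤ B * Real.exp (-(δ * treeLength (kingDist L jv)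
      (U ∪ univ.image (fun l => basePt (L ^ jv.K) (kingVol L jv) (b l))))))
    (A : Tor (kingVol L jv) → ℝ)
    (hA : haveI := kingVol_neZero L jv; ∀ b, |A b| ≤ a * (1 + kingDist L jv (basePt (L ^ jv.K) (kingVol L jv) b) u₀)) :
    haveI := kingVol_neZero L jv
    |∑ b : Fin r → Tor (kingVol L jv), (∏ l, A (b l)) * E b|
      ≤ B * Real.exp (-(δ / 2 * treeLength (kingDist L jv) U))
          * (a * (1 + 4 * r / δ) * (Real.exp (δ / (4 * r)) * latticeConst (d + 1) (δ / (4 * r)))) ^ r := by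
  haveI := kingVol_neZero L jv
  have hr0 : (0 : ℝ) < r := by exact_mod_cast hr
  have hc : 0 < δ / (4 * r) := by positivity
  exact sum_fieldPoints_treeDecay (kingDist_nonneg L jv) (kingDist_self L jv) (kingDist_symm L jv) (kingDist_triangle L jv) hu₀
    (fun b => basePt (L ^ jv.K) (kingVol L jv) b) hr hδ ha hB E hE A hA (sum_exp_kingDist_basePt_le L jv hc u₀)

end FieldPointsKing

end Summit.QuantumFields.YangMills.BalabanUVNodes.N15KingModelRung.Curved

end
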